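import Summits.HubbardSuperconductivity.HubbardSuperconductivity.Theorems.AnisotropyChordTransferFibre3KT2aRow
import Summits.HubbardSuperconductivity.HubbardSuperconductivity.Theorems.AnisotropyChordTransferFibre3RowCGradSup
import Summits.HubbardSuperconductivity.HubbardSuperconductivity.Theorems.AnisotropyChordTransferFibre3TtailBounds
import Summits.HubbardSuperconductivity.HubbardSuperconductivity.Theorems.AnisotropyChordTransferFibre3Lam2Small

/-!
# Route `AnisotropyChord` / H0 rotor rung: PartN41-D §2/§3 — the profile transforms (`YfunSplit`, `FhatClosed`′, `ProfileTransforms` PROVED)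

First proofs against theory-1 g22's PartN41-D (port …Fibre3KT2aRow, the KT-2a row): ★ `yfunSplit_holds : YfunSplit L`
(`Y_e = F̂₂ − φ̂_e`, linearity of `dft`); ★ `fhat_closed`: `f̂(0) = V`, `f̂(p) = −a − c_s g(p)` for `p ≠ 0` — the body of `FhatClosed`
under the extra hypothesis `λ₂ < 2ε₁` (the typed `FhatClosed` quantifies over every two-magnon solution with `λ₂ > 0`; without
`2ε(p) ≠ λ₂` the resolvent symbol `gres` reads `0` at a resonant momentum and the identity can fail, so the typed form is not proved
here — NOTE for the theory successor); ★ `profileTransforms_holds (Δ) : ProfileTransforms L Δ` (`f̂_JU = aVδ₀ − a`,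
`f̂_S = (V(1−a)+a)δ₀ − c_s g`, `f_S = c_s a_λ`, for the ground profile, where `λ₂ < 2ε₁` holds).
Prover seat `hubbard-h0-rotor-p1` g27 (route lead); helper for stmt-HubbardSuperconductivity-23918 (`--supports`, helper class).
WHAT THIS IS NOT: nothing here proves superconductivity in the Hubbard model; inputs of ONE row of ONE conditional reduction.
Tree imports only; no new definitions; no sorry, no axioms.
-/

set_option linter.dupNamespace false
set_option autoImplicit false

noncomputable section

open scoped BigOperators

namespace Summit.HubbardSuperconductivity.HubbardSuperconductivity.Theorems.AnisotropyChord.Transfer.Fibre3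

variable (L : ℕ) [NeZero L]

/-- ★ **`YfunSplit L` holds:** `Y_e(q) = F̂₂(q) − φ̂_e(q)`. [folklore] -/
theorem yfunSplit_holds : YfunSplit L := by
  intro f e q
  unfold Yfun phiHat dft Dgrad
  rw [← Finset.sum_sub_distrib]
  refine Finset.sum_congr rfl fun b _ => ?_
  push_cast
  ring

namespace RowD

/-- `f = 1 − s − aδ₀` pointwise (two-magnon `f`: `f(0) = 0`). [folklore] -/
theorem f_eq_one_sub_s {Δ lam2 : ℝ} {f : Tor L → ℝ} (hf : IsTwoMagnon L Δ lam2 f) (r : Tor L) :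
    f r = 1 - sfun' L Δ f r - (if r = 0 then Δ * f (K1 L) else 0) := by
  unfold sfun'
  by_cases hr : r = 0
  · rw [if_pos hr, if_pos hr, hr, hf.1]; ring
  · rw [if_neg hr, if_neg hr]; ring

/-- ★ `f̂` CLOSED under `λ₂ < 2ε₁`: the body of `FhatClosed` (`L ≥ 3`). [folklore] -/
theorem fhat_closed (hL : 3 ≤ L) {Δ lam2 : ℝ} {f : Tor L → ℝ} (hf : IsTwoMagnon L Δ lam2 f)
    (hl2 : lam2 < 2 * eps1 L) (p : Tor L) :
    dft L f p = (((if p = 0 then (L : ℝ) ^ 2 + Δ * f (K1 L) else 0) + Bhat L Δ lam2 f p : ℝ) : ℂ) := by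
  classical
  have hs := dft_sfun' L hL hf hl2 p
  -- `f̂ = Σ conj φ − ŝ − a`
  have e1 : dft L f p = (∑ r : Tor L, (starRingEnd ℂ) (phase L p r)) - dft L (sfun' L Δ f) p
      - ((Δ * f (K1 L) : ℝ) : ℂ) := by
    unfold dft
    have hpt : ∀ r : Tor L, (starRingEnd ℂ) (phase L p r) * ((f r : ℝ) : ℂ)
        = (starRingEnd ℂ) (phase L p r) - (starRingEnd ℂ) (phase L p r) * ((sfun' L Δ f r : ℝ) : ℂ)
          - (if r = 0 then (starRingEnd ℂ) (phase L p r) * ((Δ * f (K1 L) : ℝ) : ℂ) else 0) := by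
      intro r; rw [f_eq_one_sub_s L hf r]; split_ifs <;> push_cast <;> ring
    rw [Finset.sum_congr rfl fun r _ => hpt r, Finset.sum_sub_distrib, Finset.sum_sub_distrib,
      Finset.sum_ite_eq' Finset.univ (0 : Tor L)]
    simp only [Finset.mem_univ, if_true]
    rw [phase_zero, map_one, one_mul]
  rw [e1, sum_conj_phase_right, hs]
  unfold Bhat gres
  by_cases hp : p = 0
  · simp only [if_pos hp]; push_cast; ring
  · simp only [if_neg hp]; push_cast; ring

/-- `f̂_JU(q) = aV[q=0] − a`. [folklore] -/
theorem dft_fJU (Δ : ℝ) (f : Tor L → ℝ) (q : Tor L) :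
    dft L (fJU L Δ f) q = (((if q = 0 then Δ * f (K1 L) * (L : ℝ) ^ 2 else 0) - Δ * f (K1 L) : ℝ) : ℂ) := by
  classical
  unfold dft fJU
  have hpt : ∀ r : Tor L, (starRingEnd ℂ) (phase L q r) * (((if r = 0 then (0 : ℝ) else Δ * f (K1 L)) : ℝ) : ℂ)
      = (starRingEnd ℂ) (phase L q r) * ((Δ * f (K1 L) : ℝ) : ℂ)
        - (if r = 0 then (starRingEnd ℂ) (phase L q r) * ((Δ * f (K1 L) : ℝ) : ℂ) else 0) := by
    intro r; split_ifs <;> push_cast <;> ring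
  rw [Finset.sum_congr rfl fun r _ => hpt r, Finset.sum_sub_distrib, Finset.sum_ite_eq' Finset.univ (0 : Tor L)]
  simp only [Finset.mem_univ, if_true]
  rw [phase_zero, map_one, one_mul, ← Finset.sum_mul, sum_conj_phase_right]
  by_cases hq : q = 0
  · simp only [if_pos hq]; push_cast; ring
  · simp only [if_neg hq]; push_cast; ring

/-- `f̂_S = f̂ − f̂_JU`. [folklore] -/
theorem dft_fS (Δ : ℝ) (f : Tor L → ℝ) (q : Tor L) :
    dft L (fS L Δ f) q = dft L f q - dft L (fJU L Δ f) q := by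
  unfold dft fS
  rw [← Finset.sum_sub_distrib]
  refine Finset.sum_congr rfl fun r _ => ?_
  push_cast; ring

end RowD

/-- ★ **`ProfileTransforms L Δ` holds.** [folklore] -/
theorem profileTransforms_holds (Δ : ℝ) : ProfileTransforms L Δ := by
  intro lam2 f hL hΔ0 hΔ1 hf q
  have hl2 := lam2_lt_two_eps1 L hL hΔ0 hf
  refine ⟨RowD.dft_fJU L Δ f q, ?_, ?_⟩
  · rw [RowD.dft_fS, RowD.fhat_closed L (by omega) hf.1 hl2 q, RowD.dft_fJU]
    unfold Bhat
    split_ifs <;> push_cast <;> ring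
  · intro r
    unfold fS fJU
    by_cases hr : r = 0
    · rw [if_pos hr, hr, hf.1.1, OneHoleTorus.aKer_zero]; ring
    · rw [if_neg hr, ground_profile_aKer L hL hΔ0 hΔ1 hf hr]; ring

end Summit.HubbardSuperconductivity.HubbardSuperconductivity.Theorems.AnisotropyChord.Transfer.Fibre3

end
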